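import Mathlib
import HarnessLib
import Summits.AtomisticToContinuum.HydrodynamicLimit.Theses.RelayRaceLocality
import Literature.MathematicalPhysics.KineticTheory.HardSphereEulerProofs
import Literature.MathematicalPhysics.KineticTheory.HardSphereCanonicalTorus

/-!
# RelayRaceLocality · ConeLocalisation — the near-constant core

Support file for item `stmt-AtomisticToContinuum-12504` (`ConeLocalisation`, route
RelayRaceLocality of `AtomisticToContinuum/HydrodynamicLimit`).

`ConeLocalisation` is the glue `LightConeInLaw → NearConstantShortTimeHL → S`, where `S` is the
short-time guarded hydrodynamic limit for the conjunct's family (`N + 1` spheres of diameter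
`hsDiameter σ N`, local Gibbs law `localGibbsLaw σ a₀ u₀ θ₀ N`). This file proves the part of the
glue that needs no light cone: for Euler data that are ALREADY near-constant
(`|ρ(0) - 1|, ‖u(0) - ū‖, |θ(0) - θ̄| ≤ δ₀(M)`), `S` follows from `NearConstantShortTimeHL` alone,
because the conjunct's family is an admissible `(ε_N, n_N)` family of the crux
(`ε_N = hsDiameter σ N → 0`, `n_N ε_N³ = (N+1) ε_N³ = σ³`), its canonical laws are literally
`localGibbsLaw` (definitional), and they are probability measures for `σ ≤ 1/2`
(`isProbabilityMeasure_localGibbsLaw`), so the probability-measure premise of the crux is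
discharged by shrinking `σ₀` below `1/2`.
-/

namespace Summit.AtomisticToContinuum.HydrodynamicLimit.Theorems

open scoped Topology
open Filter Set MeasureTheory
open Literature.MathematicalPhysics.KineticTheory Literature.Analysis.FluidPDE
  Literature.Analysis.FunctionSpaces

/-- **Near-constant core of `ConeLocalisation`.** `NearConstantShortTimeHL` implies the
short-time guarded hydrodynamic limit `S` of `RestartPrinciple`/`ConeLocalisation` for the
conjunct's family, restricted to classical Euler solutions whose time-`0` data are
`δ₀(M)`-close to a constant state: `∃ η₀ ∀ M ∃ δ₀ τ₁ ∀ profiles ∃ σ₀ ∀ σ < σ₀ ∀ solutions with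
near-constant data ∀ flows, LLN at 0 ⇒ (guards on [0,t], t < min T τ₁ ⇒ LLN at t)`. The guards
are those of `S` (bounds up to third derivatives); only the `C¹` part is used. [folklore] -/
theorem relayRaceLocality_nearConstantCore
    (hNC : Theses.RelayRaceLocality.NearConstantShortTimeHL) :
    ∃ η₀ : ℝ, 0 < η₀ ∧ ∀ M : ℝ, 0 < M → ∃ δ₀ : ℝ, 0 < δ₀ ∧ ∃ τ₁ : ℝ, 0 < τ₁ ∧
      ∀ (a₀ θ₀ : T3 → ℝ) (u₀ : T3 → V3), Continuous a₀ → Continuous θ₀ → Continuous u₀ →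
      (∀ x, 0 < a₀ x) → (∀ x, 0 < θ₀ x) → ∃ σ₀ : ℝ, 0 < σ₀ ∧ ∀ σ : ℝ, 0 < σ → σ < σ₀ →
      ∀ (T : ℝ) (ρ θ : ℝ → T3 → ℝ) (u : ℝ → T3 → V3), IsHardSphereEulerSolution σ T ρ u θ →
      (∃ (ubar : V3) (θbar : ℝ), ∀ x, |ρ 0 x - 1| ≤ δ₀ ∧ ‖u 0 x - ubar‖ ≤ δ₀ ∧ |θ 0 x - θbar| ≤ δ₀) →
      ∀ Φ : (N : ℕ) → HardSphereFlow (Torus.geometry (Fin 3)) (hsDiameter σ N) (N + 1),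
      TendstoHydroFieldsAt (fun N => localGibbsLaw σ a₀ u₀ θ₀ N (Φ N)) Φ ρ u θ 0 →
      ∀ t ∈ Set.Ico 0 (min T τ₁), (∀ s ∈ Set.Icc 0 t, ∀ x, ρ s x * σ ^ 3 < η₀ ∧ ρ s x ≤ M ∧
        θ s x ≤ M ∧ M⁻¹ ≤ θ s x ∧ ‖u s x‖ ≤ M ∧ ∀ i j k : Fin 3,
        |Torus.partialDeriv i (ρ s) x| ≤ M ∧ ‖Torus.partialDeriv i (u s) x‖ ≤ M ∧
        |Torus.partialDeriv i (θ s) x| ≤ M ∧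
        |Torus.partialDeriv i (Torus.partialDeriv j (ρ s)) x| ≤ M ∧
        ‖Torus.partialDeriv i (Torus.partialDeriv j (u s)) x‖ ≤ M ∧
        |Torus.partialDeriv i (Torus.partialDeriv j (θ s)) x| ≤ M ∧
        |Torus.partialDeriv i (Torus.partialDeriv j (Torus.partialDeriv k (ρ s))) x| ≤ M ∧
        ‖Torus.partialDeriv i (Torus.partialDeriv j (Torus.partialDeriv k (u s))) x‖ ≤ M ∧
        |Torus.partialDeriv i (Torus.partialDeriv j (Torus.partialDeriv k (θ s))) x| ≤ M) →
      TendstoHydroFieldsAt (fun N => localGibbsLaw σ a₀ u₀ θ₀ N (Φ N)) Φ ρ u θ t := by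
  obtain ⟨η₀, hη₀, H⟩ := hNC
  refine ⟨η₀, hη₀, fun M hM => ?_⟩
  obtain ⟨δ₀, hδ₀, τ₀, hτ₀, H1⟩ := H M hM
  refine ⟨δ₀, hδ₀, τ₀, hτ₀, fun a₀ θ₀ u₀ ha hθ hu ha0 hθ0 => ?_⟩
  obtain ⟨σ₀, hσ₀, H2⟩ := H1 a₀ θ₀ u₀ ha hθ hu ha0 hθ0
  refine ⟨min σ₀ (1 / 2), lt_min hσ₀ (by norm_num), fun σ hσ hσlt T ρ θ u hE hnc Φ h0 t ht hg => ?_⟩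
  have hσ₁ : σ < σ₀ := lt_of_lt_of_le hσlt (min_le_left _ _)
  have hσ2 : σ ≤ 1 / 2 := (lt_of_lt_of_le hσlt (min_le_right _ _)).le
  have hε : ∀ N : ℕ, 0 < hsDiameter σ N := fun N => hsDiameter_pos hσ N
  have hε0 : Tendsto (fun N => hsDiameter σ N) atTop (𝓝 0) := tendsto_hsDiameter σ
  have hn : Tendsto (fun N : ℕ => (((N + 1 : ℕ)) : ℝ) * hsDiameter σ N ^ 3) atTop (𝓝 (σ ^ 3)) := by
    simp only [succ_mul_hsDiameter_pow_three]
    exact tendsto_const_nhds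
  have hP : ∀ N : ℕ, IsProbabilityMeasure (localGibbsLaw σ a₀ u₀ θ₀ N (Φ N)) := fun N =>
    isProbabilityMeasure_localGibbsLaw ha hθ hu ha0 hθ0 hσ2 N (Φ N)
  have H3 := H2 σ hσ hσ₁ (fun N => hsDiameter σ N) (fun N => N + 1) hε hε0 hn T ρ θ u hE hnc Φ
    hP h0 t ht (fun s hs x => ?_)
  · exact H3
  · obtain ⟨g1, g2, g3, g4, g5, g6⟩ := hg s hs x
    exact ⟨g1, g3, g4, g5, fun i => ⟨(g6 i i i).1, (g6 i i i).2.1, (g6 i i i).2.2.1⟩⟩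

end Summit.AtomisticToContinuum.HydrodynamicLimit.Theorems
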